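/-
PORT (pub-hodgecm2, COR-CM cell) of the stage-1 package file `HodgeCMPerL/HodgeCM/Prior/AllgGroup.lean`
(pub-hodgecm HOME/lean, bytes of record md5 e43c351093c0, 535 lines). Declarations VERBATIM; edits: imports rewritten to tree
modules, namespace token `HodgeCM` ↦ `Summit.HodgeConjecture.CorCM`, package `conjRingHomK` ↦ tree `Literature.NumberTheory.Automorphic.cmConjRingHom`
(definitionally equal bodies), linter fixes. Generator: pub-hodgecm2-p1 `work/port/build_kit.py`.
-/
import Mathlib

/-!
# Prior-program stockroom file `Hodge_WRankFourWeilFacesY1_RfwfAllgGroup`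

Imported from the 2001 program: `summits/hodge-w-rank-four-weil-faces/free/y1/lean/RfwfAllgGroup.lean` (commit a463a4c8cc18),
free `y1` of summit `hodge-w-rank-four-weil-faces`; prior STATUS `upheld`; imported 2026-08-13.
Relevant to: Summit.HodgeConjecture.HodgeConjecture (the statement via the prior narrowed target `hodge-w-rank-four-weil-faces`); container free `y1`
Inspiration note: none (not a primary-summit route).
Existing Theses decls it bears on: not assessed at import (planners/provers decide; see reserve/prior-2001/README.md).
Mechanical changes only: provenance header, whole body wrapped in the namespace below (original namespaces nested
inside), stub docstrings on undocumented declarations, `#print`/`#check`/`#eval` lines dropped. Proofs untouched.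
NOT part of the `lean/` tree: it enters `Summits/…/Theorems` only when a prover adapts it to a Theses decl (route item).
-/

namespace Summit.HodgeConjecture.CorCM.Prior.AllgGroup

/-
T1 (group form) — Lemma l:allg / the relation lattice R_F, for every finite group G with
an involution c ≠ 1.
Sources: summits/hodge-w-rank-four-weil-faces/free/y1/work/COR-CM.md §(a) l.8-14 ("For a
Galois CM field F of degree 2g, R_F := ker(Z[types] → Z[G], Φ ↦ 1_Φ) equals R_g under this
identification ... and the face relations of F are exactly these second differences");
free/y1/paper/paper.tex l.273-282 (R_F := ker(Z[types] → Z[G]), face relations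
r(Φ;π,π') = [Φ]+[Φ^{(ππ')}]−[Φ^{(π)}]−[Φ^{(π')}]); free/x1/work/AUDIT-corcm.md §1 (1a).

Here the statement is proved DIRECTLY at the group level (it therefore contains the
cube lemma of RfwfAllgCube.lean and the identification R_F = R_g in one statement):
  G a finite group, c : G with c*c = 1, c ≠ 1 (the source's c is additionally central;
  centrality is NOT needed for this combinatorial statement, so it is not assumed).
  CM types: Finsets Φ ⊆ G with ∀ x, x ∈ Φ ↔ c*x ∉ Φ  (i.e. G = Φ ⊔ cΦ).
  typeSum : Z[types] → Z[G] = (G → ℤ), [Φ] ↦ 1_Φ;  R_F := ker typeSum.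
  Places = c-orbits {t, c*t}; Φ^{(π)} = Φ ∆ {t, c*t}; faces = second differences
  [Φ] + [Φ^{(ππ')}] − [Φ^{(π)}] − [Φ^{(π')}] over distinct places.
MAIN THEOREM `gfaces_generate`: span ℤ (faces) = ker typeSum — integral generation
(index 1), for ALL such (G, c), i.e. for all g = |G|/2 ≥ 1 at once.
(For g = 1, |G| = 2, there are no distinct places and the kernel is 0: the statement
still holds, both sides being ⊥ — no small-g caveat is needed.)
The proof is COR-CM (a)'s three-line induction, run on the deviation set T₀ \ Φ from a
fixed base type T₀ (which exists for every (G, c) with c² = 1, c ≠ 1: `exists_isCMF`).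
-/
namespace RfwfAllgGroup

noncomputable section

open Finsupp

open scoped symmDiff

variable {G : Type*} [Group G] [Fintype G] [DecidableEq G]

/-- CM-type property: `Φ` contains exactly one of `x`, `c*x` for every `x` (`G = Φ ⊔ cΦ`). -/
def IsCMF (c : G) (Φ : Finset G) : Prop := ∀ x : G, x ∈ Φ ↔ c * x ∉ Φ

/-- The CM types of `(G, c)`. -/
abbrev CMF (G : Type*) [Group G] [Fintype G] [DecidableEq G] (c : G) :=
  {Φ : Finset G // IsCMF c Φ}

variable (c : G)

/-- Integer indicator `1_Φ ∈ Z[G]`. -/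
def indG (Φ : Finset G) : G → ℤ := fun x => if x ∈ Φ then 1 else 0

/-- The type-sum map `Z[types] → Z[G]`, `[Φ] ↦ 1_Φ` (paper l.276; COR-CM (a) l.12-13). -/
def typeSum (G : Type*) [Group G] [Fintype G] [DecidableEq G] (c : G) :
    (CMF G c →₀ ℤ) →ₗ[ℤ] (G → ℤ) :=
  Finsupp.lsum ℤ fun Φ => LinearMap.toSpanSingleton ℤ (G → ℤ) (indG Φ.1)

/-- (no docstring in the 2001 source) -/
@[simp] lemma typeSum_single (Φ : CMF G c) : typeSum G c (single Φ 1) = indG Φ.1 := by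
  simp [typeSum]

/-- The place (c-orbit) `{t, c*t}` of `t`. -/
def orb (t : G) : Finset G := {t, c * t}

omit [Fintype G] in
/-- (no docstring in the 2001 source) -/
lemma mem_orb {t x : G} : x ∈ orb c t ↔ x = t ∨ x = c * t := by simp [orb]

/-- Flip a type at the place of `t`: `Φ^{(π)} = Φ ∆ {t, c*t}`. -/
def oflip (t : G) (Φ : Finset G) : Finset G := Φ ∆ orb c t

omit [Fintype G] [DecidableEq G] in
/-- (no docstring in the 2001 source) -/
lemma cmul_cmul (hc2 : c * c = 1) (y : G) : c * (c * y) = y := by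
  rw [← mul_assoc, hc2, one_mul]

omit [Fintype G] in
/-- (no docstring in the 2001 source) -/
lemma cmul_mem_orb (hc2 : c * c = 1) {t x : G} (hx : x ∈ orb c t) : c * x ∈ orb c t := by
  rcases (mem_orb c).mp hx with h | h <;> subst h <;> rw [mem_orb]
  · right; rfl
  · left; exact cmul_cmul c hc2 t

omit [Fintype G] in
/-- Flipping at a place preserves the CM-type property. -/
lemma isCMF_oflip (hc2 : c * c = 1) {Φ : Finset G} (hΦ : IsCMF c Φ) (t : G) :
    IsCMF c (oflip c t Φ) := by
  intro x
  by_cases hxO : x ∈ orb c t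
  · have hcxO : c * x ∈ orb c t := cmul_mem_orb c hc2 hxO
    rw [oflip, Finset.mem_symmDiff, Finset.mem_symmDiff]
    have hx := hΦ x
    have hcx := hΦ (c * x)
    rw [cmul_cmul c hc2 x] at hcx
    tauto
  · have hcxO : c * x ∉ orb c t := fun h => hxO (by
      have := cmul_mem_orb c hc2 h
      rwa [cmul_cmul c hc2 x] at this)
    rw [oflip, Finset.mem_symmDiff, Finset.mem_symmDiff]
    have hx := hΦ x
    tauto

/-- The flip as an operation on CM types. -/
def oflipCM (hc2 : c * c = 1) (t : G) (Φ : CMF G c) : CMF G c :=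
  ⟨oflip c t Φ.1, isCMF_oflip c hc2 Φ.2 t⟩

/-- The face relation `[Φ] + [Φ^{(ππ')}] − [Φ^{(π)}] − [Φ^{(π')}]` at the places of
`t, t'` (paper l.277-278; COR-CM (a) l.14). -/
def gface (hc2 : c * c = 1) (Φ : CMF G c) (t t' : G) : CMF G c →₀ ℤ :=
  single Φ 1 + single (oflipCM c hc2 t (oflipCM c hc2 t' Φ)) 1
    - single (oflipCM c hc2 t Φ) 1 - single (oflipCM c hc2 t' Φ) 1

/-- All face relations over pairs of DISTINCT places (`t' ∉ {t, c*t}`). -/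
def gfaceSet (G : Type*) [Group G] [Fintype G] [DecidableEq G] (c : G)
    (hc2 : c * c = 1) : Set (CMF G c →₀ ℤ) :=
  {y | ∃ (Φ : CMF G c) (t t' : G), t' ∉ orb c t ∧ y = gface c hc2 Φ t t'}

omit [Fintype G] in
/-- (no docstring in the 2001 source) -/
lemma indG_oflip_of_mem {Φ : Finset G} {t x : G} (hx : x ∈ orb c t) :
    indG (oflip c t Φ) x = 1 - indG Φ x := by
  unfold indG oflip
  by_cases hxΦ : x ∈ Φ
  · rw [if_pos hxΦ, if_neg (by rw [Finset.mem_symmDiff]; tauto)]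
    norm_num
  · rw [if_neg hxΦ, if_pos (by rw [Finset.mem_symmDiff]; tauto)]
    norm_num

omit [Fintype G] in
/-- (no docstring in the 2001 source) -/
lemma indG_oflip_of_not_mem {Φ : Finset G} {t x : G} (hx : x ∉ orb c t) :
    indG (oflip c t Φ) x = indG Φ x := by
  unfold indG oflip
  by_cases hxΦ : x ∈ Φ
  · rw [if_pos hxΦ, if_pos (by rw [Finset.mem_symmDiff]; tauto)]
  · rw [if_neg hxΦ, if_neg (by rw [Finset.mem_symmDiff]; tauto)]

/-- Faces lie in the kernel of the type-sum map. -/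
lemma typeSum_gface (hc2 : c * c = 1) (Φ : CMF G c) {t t' : G} (ht' : t' ∉ orb c t) :
    typeSum G c (gface c hc2 Φ t t') = 0 := by
  have hct' : c * t' ∉ orb c t := by
    intro h
    rcases (mem_orb c).mp h with h1 | h1
    · apply ht'
      rw [mem_orb]
      right
      rw [← h1, cmul_cmul c hc2]
    · exact ht' (by rw [mem_orb]; left; exact mul_left_cancel h1)
  have hdisj : ∀ y : G, y ∈ orb c t → y ∉ orb c t' := by
    intro y hy hy'
    rcases (mem_orb c).mp hy' with h1 | h1
    · exact ht' (h1 ▸ hy)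
    · exact hct' (h1 ▸ hy)
  unfold gface
  rw [map_sub, map_sub, map_add, typeSum_single, typeSum_single, typeSum_single,
    typeSum_single]
  funext x
  simp only [Pi.add_apply, Pi.sub_apply, Pi.zero_apply]
  show indG Φ.1 x + indG (oflip c t (oflip c t' Φ.1)) x
      - indG (oflip c t Φ.1) x - indG (oflip c t' Φ.1) x = 0
  by_cases hxt : x ∈ orb c t
  · have hxt' : x ∉ orb c t' := hdisj x hxt
    rw [indG_oflip_of_mem c hxt, indG_oflip_of_not_mem c hxt', indG_oflip_of_mem c hxt]
    ring
  · by_cases hxt' : x ∈ orb c t'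
    · rw [indG_oflip_of_not_mem c hxt, indG_oflip_of_mem c hxt',
        indG_oflip_of_not_mem c hxt]
      ring
    · rw [indG_oflip_of_not_mem c hxt, indG_oflip_of_not_mem c hxt',
        indG_oflip_of_not_mem c hxt]
      ring

/-- Every `(G, c)` with `c² = 1`, `c ≠ 1` has a CM type (pick one element per c-orbit;
induction removing one orbit at a time). -/
lemma exists_isCMF (hc2 : c * c = 1) (hc1 : c ≠ 1) : ∃ Φ : Finset G, IsCMF c Φ := by
  suffices h : ∀ (n : ℕ) (S : Finset G), S.card = n → (∀ x ∈ S, c * x ∈ S) →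
      ∃ T : Finset G, T ⊆ S ∧ ∀ x ∈ S, (x ∈ T ↔ c * x ∉ T) by
    obtain ⟨T, -, hT⟩ := h (Finset.univ.card) Finset.univ rfl (fun x _ => Finset.mem_univ _)
    exact ⟨T, fun x => hT x (Finset.mem_univ x)⟩
  intro n
  induction n using Nat.strong_induction_on with
  | h n ih =>
  intro S hcard hSc
  by_cases hS : S = ∅
  · subst hS
    exact ⟨∅, Finset.Subset.refl _, by simp⟩
  · obtain ⟨a, ha⟩ := Finset.nonempty_iff_ne_empty.mpr hS
    have hca : c * a ∈ S := hSc a ha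
    have hane : c * a ≠ a := by
      intro h
      exact hc1 (mul_right_cancel (h.trans (one_mul a).symm))
    set S' : Finset G := S \ {a, c * a} with hS'
    have hsub : S' ⊆ S := by rw [hS']; exact Finset.sdiff_subset
    have hS'c : ∀ x ∈ S', c * x ∈ S' := by
      intro x hx
      rw [hS', Finset.mem_sdiff] at hx ⊢
      obtain ⟨hxS, hxn⟩ := hx
      refine ⟨hSc x hxS, ?_⟩
      intro hmem
      rcases Finset.mem_insert.mp hmem with h1 | h1
      · refine hxn ?_
        rw [Finset.mem_insert, Finset.mem_singleton]
        right
        rw [← h1, cmul_cmul c hc2]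
      · rw [Finset.mem_singleton] at h1
        refine hxn ?_
        rw [Finset.mem_insert]
        left
        exact mul_left_cancel h1
    have hanotin : a ∉ S' := by
      rw [hS', Finset.mem_sdiff]
      rintro ⟨-, hne⟩
      exact hne (Finset.mem_insert_self a _)
    have hcaS' : c * a ∉ S' := by
      rw [hS', Finset.mem_sdiff]
      rintro ⟨-, hne⟩
      refine hne ?_
      rw [Finset.mem_insert, Finset.mem_singleton]
      right
      rfl
    have hcard' : S'.card < n := by
      rw [← hcard]
      exact Finset.card_lt_card ((Finset.ssubset_iff_of_subset hsub).mpr ⟨a, ha, hanotin⟩)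
    obtain ⟨T', hT'sub, hT'⟩ := ih S'.card hcard' S' rfl hS'c
    have hcaT' : c * a ∉ T' := fun h => hcaS' (hT'sub h)
    refine ⟨insert a T', Finset.insert_subset ha (hT'sub.trans hsub), ?_⟩
    intro x hxS
    by_cases hxa : x = a
    · subst hxa
      constructor
      · intro _ hmem
        rcases Finset.mem_insert.mp hmem with h1 | h1
        · exact hane h1
        · exact hcaS' (hT'sub h1)
      · intro _
        exact Finset.mem_insert_self x T'
    · by_cases hxca : x = c * a
      · subst hxca
        constructor
        · intro hmem
          rcases Finset.mem_insert.mp hmem with h1 | h1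
          · exact absurd h1 hane
          · exact absurd (hT'sub h1) hcaS'
        · intro hmem
          exfalso
          apply hmem
          rw [cmul_cmul c hc2]
          exact Finset.mem_insert_self a T'
      · have hxS' : x ∈ S' := by
          rw [hS', Finset.mem_sdiff]
          refine ⟨hxS, ?_⟩
          rw [Finset.mem_insert, Finset.mem_singleton]
          tauto
        have hcxa : c * x ≠ a := by
          intro h
          apply hxca
          rw [← h, cmul_cmul c hc2]
        have hx' := hT' x hxS'
        rw [Finset.mem_insert, Finset.mem_insert]
        tauto

/-- If the deviation set from the base type is empty, the type IS the base type. -/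
lemma eq_of_dev_empty {T₀ Φ : CMF G c} (h : T₀.1 \ Φ.1 = ∅) : Φ = T₀ := by
  have hsub : T₀.1 ⊆ Φ.1 := by
    intro t ht
    by_contra htΦ
    have hmem : t ∈ T₀.1 \ Φ.1 := Finset.mem_sdiff.mpr ⟨ht, htΦ⟩
    rw [h] at hmem
    simp at hmem
  apply Subtype.ext
  apply Finset.Subset.antisymm _ hsub
  intro x hxΦ
  by_contra hxT
  have hcxT : c * x ∈ T₀.1 := by
    by_contra hh
    exact hxT ((T₀.2 x).mpr hh)
  exact ((Φ.2 x).mp hxΦ) (hsub hcxT)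

/-- If the deviation set is the singleton {s}, the type is the flip of the base at s. -/
lemma eq_oflip_of_dev_singleton (hc2 : c * c = 1) {T₀ Φ : CMF G c} {s : G}
    (h : T₀.1 \ Φ.1 = {s}) : Φ = oflipCM c hc2 s T₀ := by
  have hmem : s ∈ T₀.1 \ Φ.1 := h ▸ Finset.mem_singleton_self s
  have hsT : s ∈ T₀.1 := (Finset.mem_sdiff.mp hmem).1
  have hsΦ : s ∉ Φ.1 := (Finset.mem_sdiff.mp hmem).2
  have hcsT : c * s ∉ T₀.1 := (T₀.2 s).mp hsT
  have hcsΦ : c * s ∈ Φ.1 := by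
    by_contra hh
    exact hsΦ ((Φ.2 s).mpr hh)
  have hother : ∀ t, t ∈ T₀.1 → t ≠ s → t ∈ Φ.1 := by
    intro t htT hts
    by_contra htΦ
    have hmem2 : t ∈ T₀.1 \ Φ.1 := Finset.mem_sdiff.mpr ⟨htT, htΦ⟩
    rw [h, Finset.mem_singleton] at hmem2
    exact hts hmem2
  apply Subtype.ext
  show Φ.1 = oflip c s T₀.1
  ext x
  rw [oflip, Finset.mem_symmDiff, mem_orb]
  by_cases hxs : x = s
  · subst hxs
    simp [hsΦ, hsT]
  · by_cases hxcs : x = c * s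
    · subst hxcs
      have hcss : c * s ≠ s := fun hh => hsΦ (hh ▸ hcsΦ)
      simp [hcsΦ, hcsT, hcss]
    · by_cases hxT : x ∈ T₀.1
      · simp [hother x hxT hxs, hxT, hxs, hxcs]
      · have hcxT : c * x ∈ T₀.1 := by
          by_contra hh
          exact hxT ((T₀.2 x).mpr hh)
        have hcxs : c * x ≠ s := by
          intro hh
          apply hxcs
          rw [← hh, cmul_cmul c hc2]
        have hcxΦ : c * x ∈ Φ.1 := hother _ hcxT hcxs
        have hxΦ : x ∉ Φ.1 := by
          intro hh
          exact ((Φ.2 x).mp hh) hcxΦ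
        simp [hxΦ, hxT, hxs, hxcs]

/-- Flipping at a deviation place shrinks the deviation set by exactly that place. -/
lemma dev_oflip (hc2 : c * c = 1) {T₀ Φ : CMF G c} {s : G} (hsT : s ∈ T₀.1)
    (hsΦ : s ∉ Φ.1) :
    T₀.1 \ (oflipCM c hc2 s Φ).1 = (T₀.1 \ Φ.1).erase s := by
  have hcsT : c * s ∉ T₀.1 := (T₀.2 s).mp hsT
  ext t
  rw [Finset.mem_erase, Finset.mem_sdiff, Finset.mem_sdiff]
  show t ∈ T₀.1 ∧ t ∉ oflip c s Φ.1 ↔ t ≠ s ∧ t ∈ T₀.1 ∧ t ∉ Φ.1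
  rw [oflip, Finset.mem_symmDiff, mem_orb]
  by_cases hts : t = s
  · subst hts
    simp [hsT, hsΦ]
  · by_cases htT : t ∈ T₀.1
    · have htcs : t ≠ c * s := fun hh => hcsT (hh ▸ htT)
      simp [htT, hts, htcs]
    · simp [htT]

/-- The linear section of the type-sum map used in the induction:
`θ(f) = Σ_{t ∈ T₀} f(c·t) ([T₀^{(t)}] − [T₀]) + (f(1) + f(c·1)) [T₀]`
(on `f = 1_Φ` this is the normal form Σ_{t ∈ T₀\Φ}[T₀^{(t)}] − (|T₀\Φ|−1)[T₀]). -/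
def thetaG (hc2 : c * c = 1) (T₀ : CMF G c) : (G → ℤ) →ₗ[ℤ] (CMF G c →₀ ℤ) :=
  (∑ t ∈ T₀.1, LinearMap.smulRight
      (LinearMap.proj (R := ℤ) (φ := fun _ : G => ℤ) (c * t))
      (single (oflipCM c hc2 t T₀) 1 - single T₀ 1))
    + LinearMap.smulRight
        (LinearMap.proj (R := ℤ) (φ := fun _ : G => ℤ) (1 : G)
          + LinearMap.proj (R := ℤ) (φ := fun _ : G => ℤ) (c * 1))
        (single T₀ 1)

/-- (no docstring in the 2001 source) -/
lemma thetaG_apply (hc2 : c * c = 1) (T₀ : CMF G c) (f : G → ℤ) :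
    thetaG c hc2 T₀ f
      = (∑ t ∈ T₀.1, f (c * t) • (single (oflipCM c hc2 t T₀) 1 - single T₀ 1))
        + (f 1 + f (c * 1)) • single T₀ 1 := by
  simp [thetaG, LinearMap.sum_apply, LinearMap.smulRight_apply, LinearMap.add_apply,
    LinearMap.proj_apply]


end
end RfwfAllgGroup
end Summit.HodgeConjecture.CorCM.Prior.AllgGroup
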